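import Literature.Probability.RandomPlanarGeometry.HexSAWStripSurfaceThresholdRate
import Mathlib.Algebra.Polynomial.Roots
import HarnessLib

/-!
# The coefficient identity at the threshold: `β_{T,m} − y*·β_{T,m+1} = √2·cos(3π/8)·α_{T,m}` (door (E) of «THRESHOLD-BOOTSTRAP», discharged)

Pub `pub-sawmu`, family A — a-idea-1 gen 27, car 30 «COEFF-IDENTITY» (2026-08-24).  Lane-native; NEW module; imports the tree only.

BBdGDCG's strip identity (16) (§4.1, arXiv v5 p. 13; the tree's `HV.stripIdentityY_holds`) reads, for every `T ≥ 1`, every box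
length `L` and every `y > 0`,
  `cos(3π/8)·A_{T,L}(x_c; y) + cos(π/4)·E_{T,L}(x_c; y) + β(y)·B_{T,L}(x_c; y) = 1`,  `β(y) = (1 + √2 − y)/(√2·y)`.
The three class generating functions are POLYNOMIALS in `y` (finitely many walks in the box): `A_{T,L} = Σ_m α_{T,L,m} y^m`
(`HV.hasSum_stripAcoeffY`), `B_{T,L} = Σ_m β_{T,L,m} y^m` (`HV.hasSum_stripBcoeffY`), `E_{T,L} = Σ_m ε_{T,L,m} y^m` (this file).
Multiplying (16) by `√2·y` gives a polynomial identity valid for all `y > 0`, hence coefficientwise (a polynomial with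
infinitely many roots vanishes, `Polynomial.eq_zero_of_infinite_isRoot`); the coefficient of `y^{m+1}`, `m ≥ 1`, is
  `β_{T,L,m} − (1 + √2)·β_{T,L,m+1} = √2·cos(3π/8)·α_{T,L,m} + √2·cos(π/4)·ε_{T,L,m}`        (finite-box identity).
As `L → ∞`: `β_{T,L,m} → β_{T,m}`, `α_{T,L,m} → α_{T,m}` (the tree's monotone limits `HV.tendsto_stripBcoeffY`, `HV.tendsto_stripAcoeffY`)
and `0 ≤ ε_{T,L,m} ≤ E_{T,L}(x_c; 1) → 0` (the tree's `HV.stripELimZeroY_holds` at `y = 1 < y*`, where `B_{T,L}(x_c; 1)` is bounded,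
`HV.mem_stripBddSet_of_lt`).  Hence, for every `T ≥ 1` and `m ≥ 1`,
  ★ `β_{T,m} − y*·β_{T,m+1} = √2·cos(3π/8)·α_{T,m}`,  `y* = 1 + √2`  (`stripBcoeff_sub_yStar_mul_succ`),
i.e. the door (E) `StripCoeffIdentity T` of car 29 «THRESHOLD-BOOTSTRAP» holds with `κ = √2·cos(3π/8) = (y* − 1)·cos(3π/8) > 0`
(`stripCoeffIdentity_holds`, stated in tree terms so that this module imports the tree only).  Corollaries (every `T ≥ 1`, `m ≥ 1`):
`β_{T,m+1} ≤ β_{T,m}/y*` (`stripBcoeff_succ_le`), `√2·cos(3π/8)·α_{T,m} ≤ β_{T,m}` (`sqrt_two_cos_mul_stripAcoeff_le_stripBcoeff`).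

NOT claimed: the cut inequality (door (C)), anything at `m = 0`, the value of `α_{T,m}`.
-/

noncomputable section

open Finset Filter Topology

namespace Literature.Probability.RandomPlanarGeometry.SAW.HV

variable {T : ℕ}

/-! ### §1 Class coefficients and class polynomials -/

/-- Generic class coefficient `Σ_{γ : finalDart ∈ cls, c(γ) = m} x_c^{|γ|}` (for `cls = β`: `stripBcoeffY`; for `cls = α`: `stripAcoeffY`).
[cite: BeatonBousquetMelouDeGierDuminilCopinGuttmann2014, §2 eq. (10) (arXiv v5 p. 6: the polynomials A_{T,L}, B_{T,L}, E_{T,L})] -/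
def stripCcoeffY (T L : ℕ) (cls : HV × HV → Prop) [DecidablePred cls] (m : ℕ) : ℝ :=
  ∑ P ∈ ((midWalks (stripV T L)).filter (fun P => cls (finalDart P))).filter (fun P => surfContacts T P = m),
    hexCriticalFugacity ^ mwLen P

/-- The `ε`-coefficients `ε_{T,L,m}` of `E_{T,L}(x_c; y)`. [cite: BeatonBousquetMelouDeGierDuminilCopinGuttmann2014, §2 eq. (10) (arXiv v5 p. 6)] -/
def stripEcoeffY (T L m : ℕ) : ℝ := stripCcoeffY T L (IsEpsDart L) m

/-- [cite: BeatonBousquetMelouDeGierDuminilCopinGuttmann2014, §2 eq. (10) (arXiv v5 p. 6)] -/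
theorem stripCcoeffY_beta (T L m : ℕ) : stripCcoeffY T L (IsBetaDart T) m = stripBcoeffY T L m := rfl

/-- [cite: BeatonBousquetMelouDeGierDuminilCopinGuttmann2014, §2 eq. (10) (arXiv v5 p. 6)] -/
theorem stripCcoeffY_alpha (T L m : ℕ) : stripCcoeffY T L IsAlphaDart m = stripAcoeffY T L m := rfl

/-- [cite: BeatonBousquetMelouDeGierDuminilCopinGuttmann2014, §2 eq. (10) (arXiv v5 p. 6)] -/
theorem stripCcoeffY_eps (T L m : ℕ) : stripCcoeffY T L (IsEpsDart L) m = stripEcoeffY T L m := rfl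

/-- `0 ≤` class coefficients. [cite: BeatonBousquetMelouDeGierDuminilCopinGuttmann2014, §2 eq. (10) (arXiv v5 p. 6)] -/
theorem stripCcoeffY_nonneg (T L : ℕ) (cls : HV × HV → Prop) [DecidablePred cls] (m : ℕ) : 0 ≤ stripCcoeffY T L cls m :=
  sum_nonneg fun _ _ => pow_nonneg hexCriticalFugacity_pos_lt_one.1.le _

/-- The class generating function as a polynomial in `y`: `Σ_{γ : finalDart ∈ cls} x_c^{|γ|} X^{c(γ)}`.
[cite: BeatonBousquetMelouDeGierDuminilCopinGuttmann2014, §2 eq. (10) (arXiv v5 p. 6: "the polynomials A_{T,L}, B_{T,L} and E_{T,L}")] -/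
def stripCpoly (T L : ℕ) (cls : HV × HV → Prop) [DecidablePred cls] : Polynomial ℝ :=
  ∑ P ∈ (midWalks (stripV T L)).filter (fun P => cls (finalDart P)),
    Polynomial.C (hexCriticalFugacity ^ mwLen P) * Polynomial.X ^ surfContacts T P

/-- Evaluating the class polynomial at `y` gives `stripGFy`. [cite: BeatonBousquetMelouDeGierDuminilCopinGuttmann2014, §2 eq. (10) (arXiv v5 p. 6)] -/
theorem eval_stripCpoly (T L : ℕ) (cls : HV × HV → Prop) [DecidablePred cls] (y : ℝ) :
    (stripCpoly T L cls).eval y = stripGFy T L cls y := by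
  rw [stripCpoly, Polynomial.eval_finsetSum, stripGFy]
  refine sum_congr rfl fun P _ => ?_
  rw [Polynomial.eval_mul, Polynomial.eval_C, Polynomial.eval_pow, Polynomial.eval_X]

/-- The `m`-th coefficient of the class polynomial is the class coefficient. [cite: BeatonBousquetMelouDeGierDuminilCopinGuttmann2014, §2 eq. (10) (arXiv v5 p. 6)] -/
theorem coeff_stripCpoly (T L : ℕ) (cls : HV × HV → Prop) [DecidablePred cls] (m : ℕ) :
    (stripCpoly T L cls).coeff m = stripCcoeffY T L cls m := by
  rw [stripCpoly, Polynomial.finsetSum_coeff, stripCcoeffY]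
  conv_rhs => rw [Finset.sum_filter]
  refine sum_congr rfl fun P _ => ?_
  rw [Polynomial.coeff_C_mul, Polynomial.coeff_X_pow]
  by_cases h : surfContacts T P = m
  · simp [h]
  · simp [h, Ne.symm h]

/-- `Σ_m (class coefficient)·y^m = stripGFy` (finite sum). [cite: BeatonBousquetMelouDeGierDuminilCopinGuttmann2014, §2 eq. (10) (arXiv v5 p. 6)] -/
theorem hasSum_stripCcoeffY (T L : ℕ) (cls : HV × HV → Prop) [DecidablePred cls] (y : ℝ) :
    HasSum (fun m => stripCcoeffY T L cls m * y ^ m) (stripGFy T L cls y) := by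
  rw [← eval_stripCpoly, Polynomial.eval_eq_sum_range]
  simp_rw [coeff_stripCpoly]
  refine hasSum_sum_of_ne_finset_zero fun m hm => ?_
  rw [Finset.mem_range, not_lt] at hm
  rw [← coeff_stripCpoly, Polynomial.coeff_eq_zero_of_natDegree_lt (by omega), zero_mul]

/-- `0 ≤ ε_{T,L,m} ≤ E_{T,L}(x_c; 1)`. [cite: BeatonBousquetMelouDeGierDuminilCopinGuttmann2014, §2 eq. (10) (arXiv v5 p. 6)] -/
theorem stripEcoeffY_le_stripGFy_one (T L m : ℕ) : stripEcoeffY T L m ≤ stripGFy T L (IsEpsDart L) 1 := by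
  have h := le_hasSum (hasSum_stripCcoeffY T L (IsEpsDart L) 1) m fun j _ => by
    simpa using stripCcoeffY_nonneg T L (IsEpsDart L) j
  simpa [stripEcoeffY] using h

/-- `0 ≤ ε_{T,L,m}`. [cite: BeatonBousquetMelouDeGierDuminilCopinGuttmann2014, §2 eq. (10) (arXiv v5 p. 6)] -/
theorem stripEcoeffY_nonneg (T L m : ℕ) : 0 ≤ stripEcoeffY T L m := stripCcoeffY_nonneg T L _ m

/-! ### §2 The identity (16) as a polynomial identity and its coefficients -/

/-- `Q_{T,L}(X) := √2·cos(3π/8)·X·A(X) + √2·cos(π/4)·X·E(X) + (1 + √2 − X)·B(X) − √2·X` — (16) times `√2·y`, moved to one side.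
[cite: BeatonBousquetMelouDeGierDuminilCopinGuttmann2014, §4.1 eq. (16) (arXiv v5 p. 13); Proposition 4 eq. (11) (p. 7)] -/
def stripIdPoly (T L : ℕ) : Polynomial ℝ :=
  Polynomial.C (Real.sqrt 2 * Real.cos (3 * Real.pi / 8)) * Polynomial.X * stripCpoly T L IsAlphaDart
    + Polynomial.C (Real.sqrt 2 * Real.cos (Real.pi / 4)) * Polynomial.X * stripCpoly T L (IsEpsDart L)
    + (Polynomial.C (1 + Real.sqrt 2) - Polynomial.X) * stripCpoly T L (IsBetaDart T)
    - Polynomial.C (Real.sqrt 2) * Polynomial.X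

/-- `Q_{T,L}(y) = 0` for every `y > 0` — this is (16). [cite: BeatonBousquetMelouDeGierDuminilCopinGuttmann2014, §4.1 eq. (16) (arXiv v5 p. 13)] -/
theorem eval_stripIdPoly (hT : 1 ≤ T) (L : ℕ) {y : ℝ} (hy : 0 < y) : (stripIdPoly T L).eval y = 0 := by
  have hid := stripIdentityY_holds T L y hT hy
  unfold betaY at hid
  have hs : (0 : ℝ) < Real.sqrt 2 := by positivity
  have hβ : Real.sqrt 2 * y * ((1 + Real.sqrt 2 - y) / (Real.sqrt 2 * y)) = 1 + Real.sqrt 2 - y := by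
    field_simp
  simp only [stripIdPoly, Polynomial.eval_add, Polynomial.eval_sub, Polynomial.eval_mul, Polynomial.eval_C,
    Polynomial.eval_X, eval_stripCpoly]
  linear_combination (Real.sqrt 2 * y) * hid - stripGFy T L (IsBetaDart T) y * hβ

/-- Hence `Q_{T,L} = 0` (infinitely many roots). [cite: BeatonBousquetMelouDeGierDuminilCopinGuttmann2014, §4.1 eq. (16) (arXiv v5 p. 13); lane: coefficient extraction] -/
theorem stripIdPoly_eq_zero (hT : 1 ≤ T) (L : ℕ) : stripIdPoly T L = 0 :=
  Polynomial.eq_zero_of_infinite_isRoot _ <|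
    (Set.Ioi_infinite (0 : ℝ)).mono fun y hy => by
      rw [Set.mem_setOf_eq, Polynomial.IsRoot.def]
      exact eval_stripIdPoly hT L hy

/-- **The finite-box coefficient identity** (`m ≥ 1`): `β_{T,L,m} − y*·β_{T,L,m+1} = √2·cos(3π/8)·α_{T,L,m} + √2·cos(π/4)·ε_{T,L,m}`.
[cite: BeatonBousquetMelouDeGierDuminilCopinGuttmann2014, §4.1 eq. (16) (arXiv v5 p. 13) — the coefficient of y^{m+1} of (16)·√2y; lane: coefficient extraction] -/
theorem stripBcoeffY_sub_yStar_mul_succ (hT : 1 ≤ T) (L : ℕ) {m : ℕ} (hm : 1 ≤ m) :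
    stripBcoeffY T L m - yStar * stripBcoeffY T L (m + 1) =
      Real.sqrt 2 * Real.cos (3 * Real.pi / 8) * stripAcoeffY T L m + Real.sqrt 2 * Real.cos (Real.pi / 4) * stripEcoeffY T L m := by
  have h := congrArg (fun p : Polynomial ℝ => p.coeff (m + 1)) (stripIdPoly_eq_zero hT L)
  have hm0 : m ≠ 0 := by omega
  simp only [stripIdPoly, Polynomial.coeff_add, Polynomial.coeff_sub, Polynomial.coeff_zero, sub_mul, mul_assoc,
    Polynomial.coeff_C_mul, Polynomial.coeff_X_mul, Polynomial.coeff_mul_X, Polynomial.coeff_C, hm0, if_false,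
    coeff_stripCpoly, stripCcoeffY_beta, stripCcoeffY_alpha, stripCcoeffY_eps] at h
  unfold yStar
  linarith

/-! ### §3 The limit `L → ∞` -/

/-- `ε_{T,L,m} → 0` as `L → ∞` (`T ≥ 1`): `0 ≤ ε_{T,L,m} ≤ E_{T,L}(x_c; 1) → 0`, the tree's `StripELimZeroY` at `y = 1 < y*`.
[cite: BeatonBousquetMelouDeGierDuminilCopinGuttmann2014, proof of Proposition 9 (§4.3, arXiv v5 p. 14: E_{T,L} → 0)] -/
theorem tendsto_stripEcoeffY (hT : 1 ≤ T) (m : ℕ) : Tendsto (fun L : ℕ => stripEcoeffY T L m) atTop (𝓝 0) := by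
  obtain ⟨K, hK⟩ := (mem_stripBddSet_of_lt hT one_pos one_lt_yStar).2
  have hE := stripELimZeroY_holds T 1 K hT one_pos fun L => hK ⟨L, rfl⟩
  exact squeeze_zero (fun L => stripEcoeffY_nonneg T L m) (fun L => stripEcoeffY_le_stripGFy_one T L m) hE

/-- `0 < √2·cos(3π/8)` (`= (y* − 1)·cos(3π/8) ≈ 0.5412`). [cite: BeatonBousquetMelouDeGierDuminilCopinGuttmann2014, Proposition 4 (arXiv v5 p. 7: the coefficient cos(3π/8) of A)] -/
theorem sqrt_two_mul_cos_three_pi_div_eight_pos : 0 < Real.sqrt 2 * Real.cos (3 * Real.pi / 8) :=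
  mul_pos (by positivity) (Real.cos_pos_of_mem_Ioo ⟨by linarith [Real.pi_pos], by linarith [Real.pi_pos]⟩)

/-- ★ **THE COEFFICIENT IDENTITY** (every `T ≥ 1`, `m ≥ 1`): `β_{T,m} − y*·β_{T,m+1} = √2·cos(3π/8)·α_{T,m}`.
[cite: BeatonBousquetMelouDeGierDuminilCopinGuttmann2014, §4.1 eq. (16) (arXiv v5 p. 13) and §4.5 eq. (20) (p. 15); lane: coefficient extraction + L → ∞] -/
theorem stripBcoeff_sub_yStar_mul_succ (hT : 1 ≤ T) {m : ℕ} (hm : 1 ≤ m) :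
    stripBcoeff T m - yStar * stripBcoeff T (m + 1) = Real.sqrt 2 * Real.cos (3 * Real.pi / 8) * stripAcoeff T m := by
  set c : ℝ := Real.sqrt 2 * Real.cos (3 * Real.pi / 8) with hc
  have h1 : Tendsto (fun L : ℕ => stripBcoeffY T L m - yStar * stripBcoeffY T L (m + 1) - c * stripAcoeffY T L m) atTop
      (𝓝 (stripBcoeff T m - yStar * stripBcoeff T (m + 1) - c * stripAcoeff T m)) :=
    ((tendsto_stripBcoeffY hT m).sub ((tendsto_stripBcoeffY hT (m + 1)).const_mul yStar)).sub
      ((tendsto_stripAcoeffY hT m).const_mul c)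
  have h2 : Tendsto (fun L : ℕ => stripBcoeffY T L m - yStar * stripBcoeffY T L (m + 1) - c * stripAcoeffY T L m) atTop
      (𝓝 0) := by
    have heq : (fun L : ℕ => stripBcoeffY T L m - yStar * stripBcoeffY T L (m + 1) - c * stripAcoeffY T L m) =
        fun L : ℕ => Real.sqrt 2 * Real.cos (Real.pi / 4) * stripEcoeffY T L m := by
      funext L
      rw [stripBcoeffY_sub_yStar_mul_succ hT L hm, hc]
      ring
    rw [heq]
    simpa using (tendsto_stripEcoeffY hT m).const_mul (Real.sqrt 2 * Real.cos (Real.pi / 4))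
  have := tendsto_nhds_unique h1 h2
  linarith

/-- ★ **Door (E) of car 29 «THRESHOLD-BOOTSTRAP», in tree terms** (every `T ≥ 1`): `∃ κ > 0, ∀ m ≥ 1, β_{T,m} − y*·β_{T,m+1} = κ·α_{T,m}`
— literally `HV.StripCoeffIdentity T` of that module (same binder shape), with `κ = √2·cos(3π/8)`.
[cite: BeatonBousquetMelouDeGierDuminilCopinGuttmann2014, §4.1 eq. (16) (arXiv v5 p. 13) and §4.5 eq. (20) (p. 15); lane: coefficient extraction + L → ∞] -/
theorem stripCoeffIdentity_holds (hT : 1 ≤ T) :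
    ∃ κ : ℝ, 0 < κ ∧ ∀ m : ℕ, 1 ≤ m → stripBcoeff T m - yStar * stripBcoeff T (m + 1) = κ * stripAcoeff T m :=
  ⟨_, sqrt_two_mul_cos_three_pi_div_eight_pos, fun _ hm => stripBcoeff_sub_yStar_mul_succ hT hm⟩

/-! ### §4 Corollaries -/

/-- `√2·cos(3π/8)·α_{T,m} ≤ β_{T,m}` (`m ≥ 1`): arches are dominated by bridges, coefficientwise.
[cite: BeatonBousquetMelouDeGierDuminilCopinGuttmann2014, §4.5 eq. (20) (arXiv v5 p. 15); lane: from the coefficient identity] -/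
theorem sqrt_two_cos_mul_stripAcoeff_le_stripBcoeff (hT : 1 ≤ T) {m : ℕ} (hm : 1 ≤ m) :
    Real.sqrt 2 * Real.cos (3 * Real.pi / 8) * stripAcoeff T m ≤ stripBcoeff T m := by
  have h := stripBcoeff_sub_yStar_mul_succ hT hm
  have h1 : 0 ≤ yStar * stripBcoeff T (m + 1) := mul_nonneg yStar_pos.le (stripBcoeff_nonneg hT _)
  linarith

/-- `β_{T,m+1} ≤ β_{T,m}/y*` (`m ≥ 1`): the bridge coefficients decay at least at rate `1/y*`, termwise.
[cite: BeatonBousquetMelouDeGierDuminilCopinGuttmann2014, §4.2 (arXiv v5 p. 14: y* ≤ y_T); lane: termwise, from the coefficient identity] -/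
theorem stripBcoeff_succ_le (hT : 1 ≤ T) {m : ℕ} (hm : 1 ≤ m) : stripBcoeff T (m + 1) ≤ stripBcoeff T m / yStar := by
  have h := stripBcoeff_sub_yStar_mul_succ hT hm
  have h1 : 0 ≤ Real.sqrt 2 * Real.cos (3 * Real.pi / 8) * stripAcoeff T m :=
    mul_nonneg sqrt_two_mul_cos_three_pi_div_eight_pos.le (stripAcoeff_nonneg hT _)
  rw [le_div_iff₀ yStar_pos]
  linarith

/-- `β_{T,m} ≤ β_{T,1}·(1/y*)^{m−1}` (`m ≥ 1`). [cite: BeatonBousquetMelouDeGierDuminilCopinGuttmann2014, §4.2 (arXiv v5 p. 14); lane: iterate `stripBcoeff_succ_le`] -/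
theorem stripBcoeff_le_mul_inv_yStar_pow (hT : 1 ≤ T) {m : ℕ} (hm : 1 ≤ m) :
    stripBcoeff T m ≤ stripBcoeff T 1 * (1 / yStar) ^ (m - 1) := by
  obtain ⟨k, rfl⟩ : ∃ k, m = k + 1 := ⟨m - 1, by omega⟩
  simp only [Nat.add_sub_cancel]
  induction k with
  | zero => simp
  | succ k ih =>
    have h := stripBcoeff_succ_le hT (m := k + 1) (by omega)
    have hy := yStar_pos
    calc stripBcoeff T (k + 1 + 1) ≤ stripBcoeff T (k + 1) / yStar := h
      _ ≤ stripBcoeff T 1 * (1 / yStar) ^ k / yStar := by gcongr; exact ih (by omega)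
      _ = stripBcoeff T 1 * (1 / yStar) ^ (k + 1) := by rw [pow_succ]; ring

end Literature.Probability.RandomPlanarGeometry.SAW.HV

end
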